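import Summits.AtomisticToContinuum.Crystallization.Theorems.FrustratedLawDichotomyStrainedPatchHomCurvLJLabel
import Summits.AtomisticToContinuum.Crystallization.Theorems.FrustratedLawDichotomyStrainedPatchHomHertzSup

/-!
# The centred CURVATURE LEAF of the PURE Lennard-Jones profile: `curvCheckLJ`, the computed floor `curvLamLJ`, and soundness in the `hcurv` shape
# of hand-2's ring lemma `…HomForceRing.hcpForceLJ_slab_confinement`

decomp-a2c hand-1 g28 (crux `AperiodicFrustratedLawGap`, stmt-AtomisticToContinuum-27623; `(H) HomFloor (1/625)`, hcp half; critic rows 1085/1089 (3),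
1091 (T1): «λ must be a certified floor of Σ_{b∈B} segGd over the U-box × the whole ξ-ball»).  Verbatim the architecture of `…HomCurvLeafL2.curvCheckL2`
(centred labels: centre matrix + first-order arrays + one-sided remainder; naive labels: interval rank-one coefficients over the box; sign-vertex test
`hertzTest`) with the W₄₅ coefficient enclosures replaced by the PURE LJ ones (`ljTripleFI`, `alphaLJFI`, `phiFI`): no regimes, no junction set.

* §1 accessors (`ljLabelOK`, `A0lj`, `B0lj`, `A1qlj`, `KSlj`, `recLJ`, `naiveLJ`) and the dispatcher `labelLJ_floor` (from `…HomCurvLJLabel.label_floor_LJ`);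
* §2 arrays `EcLJ`, `EnLJ`, `GarrLJ`, `TarrLJ`, `WmatLJ`, `remLJ`, ★ `curvCheckLJ c w Lc Ln lamS`, ★ `curvLamLJ c w Lc Ln` + `curvCheckLJ_of_curvLamLJ`;
* §3 ★★★ `curvLJ_floor_of_check`: `(lamS/SC)‖U(ξ−ξ₀)‖² ≤ Σ_{b ∈ (Lc++Ln).toFinset} segGd (fun x => x⁻¹^7 − x⁻¹^13) (latPt U hexFrame b + U(hcpShift+ξ₀)) (U(ξ−ξ₀)) s`
  for EVERY `s ∈ (0,1)` (the `hcurv` input of `hcpForceLJ_slab_confinement` / `hcpForceLJ_exterior` with `B := (Lc++Ln).toFinset`).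

Kernel definitions + soundness; 0 sorry; standard axioms; no instances / notation / `#eval`.  `--supports stmt-AtomisticToContinuum-27623`.
-/

noncomputable section

namespace Summit.AtomisticToContinuum.Crystallization.Theorems.FrustratedLawDichotomyStrainedPatchHomCurvLJ

open scoped BigOperators RealInnerProductSpace
open Literature.Analysis.ValidatedNumerics.Numerics
open Summit.AtomisticToContinuum.Crystallization.Theorems.ChargedEnergyGapNegative (E3)
open Summit.AtomisticToContinuum.Crystallization.Theorems.FrustratedLawDichotomyStrainedPatchHomSplit (latPt hexFrame hcpShift)
open Summit.AtomisticToContinuum.Crystallization.Theorems.FrustratedLawDichotomyStrainedPatchHomEntryGram (entryFI mem_entryFI)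
open Summit.AtomisticToContinuum.Crystallization.Theorems.FrustratedLawDichotomyStrainedPatchHomEntryGramHcp (dot3 shufFI mem_dot3 mem_shufFI)
open Summit.AtomisticToContinuum.Crystallization.Theorems.FrustratedLawDichotomyStrainedPatchHomForceKit (vecB mem_vecB phiFI mem_phiFI)
open Summit.AtomisticToContinuum.Crystallization.Theorems.FrustratedLawDichotomyStrainedPatchHomCurvCoeff (alphaLJFI mem_alphaLJFI)
open Summit.AtomisticToContinuum.Crystallization.Theorems.FrustratedLawDichotomyStrainedPatchHomCurvCoeff3 (ljTripleFI mem_ljTripleFI kTermS)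
open Summit.AtomisticToContinuum.Crystallization.Theorems.FrustratedLawDichotomyStrainedPatchHomCurvRegime3 (alphaLJ betaLJ alpha1LJ)
open Summit.AtomisticToContinuum.Crystallization.Theorems.FrustratedLawDichotomyStrainedPatchHomCurvKit (accFI mem_accFI hessEntryFI mem_hessEntryFI)
open Summit.AtomisticToContinuum.Crystallization.Theorems.FrustratedLawDichotomyStrainedPatchHomHertzKit (hertzTest quadForm_ge_of_hertzTest hertzSup hertzSup_spec)
open Summit.AtomisticToContinuum.Crystallization.Theorems.FrustratedLawDichotomyStrainedPatchHomConvexCurvature (norm_sq_eq_sum)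
open Summit.AtomisticToContinuum.Crystallization.Theorems.FrustratedLawDichotomyStrainedPatchHomCurvCentre (pert_rearrange pert_abs_le sum_floor_collect)
open Summit.AtomisticToContinuum.Crystallization.Theorems.FrustratedLawDichotomyStrainedPatchHomCurvCentreKit
open Summit.AtomisticToContinuum.Crystallization.Theorems.FrustratedLawDichotomyStrainedPatchHomCurvLeafL (dflt3 labelSum_eq_form rem_term_le form_add3)
open Summit.AtomisticToContinuum.Crystallization.Theorems.FrustratedLawDichotomyStrainedPatchHomCurvLeaf (abs_sub_le_of_segment)
open Summit.AtomisticToContinuum.Crystallization.Theorems.FrustratedLawDichotomyStrainedPatchTaylorChord (segR segGd)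
open Summit.AtomisticToContinuum.Crystallization.Theorems.FrustratedLawDichotomyStrainedPatchHomLatticeBoxHcp (norm_shifted_gt)

/-! ## §1. Per-label accessors and the per-label floor -/

/-- Centre squared radius datum. -/
def Q0 (c : (Fin 3 × Fin 3) ⊕ Fin 3 → ℤ) (b : Fin 3 → ℤ) : FI := dot3 (cenVec c b) (cenVec c b)
/-- `(α, α′ρ, α″ρ²)` of the LJ profile over the v2 tube. -/
def ttLJ (c w : (Fin 3 × Fin 3) ⊕ Fin 3 → ℤ) (b : Fin 3 → ℤ) : Option (FI × FI × FI) := ljTripleFI ((tube2 c w b).mul (tube2 c w b))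
/-- `(α, α′ρ, α″ρ²)` of the LJ profile at the centre radius. -/
def t0LJ (c : (Fin 3 × Fin 3) ⊕ Fin 3 → ℤ) (b : Fin 3 → ℤ) : Option (FI × FI × FI) := ljTripleFI (Q0 c b)
/-- `α′(ρ₀)/ρ₀`. -/
def a1qLJ (c : (Fin 3 × Fin 3) ⊕ Fin 3 → ℤ) (b : Fin 3 → ℤ) : Option FI := FI.divPos ((t0LJ c b).getD dflt3).2.1 (Q0 c b)
/-- The label can be centred (positive tube, all enclosures succeed). -/
def ljLabelOK (c w : (Fin 3 × Fin 3) ⊕ Fin 3 → ℤ) (b : Fin 3 → ℤ) : Bool :=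
  decide (0 < (tube2 c w b).lo) && (ttLJ c w b).isSome && (t0LJ c b).isSome && (phiFI (Q0 c b)).isSome && (a1qLJ c b).isSome
/-- `α(ρ₀)` enclosure. -/
def A0lj (c : (Fin 3 × Fin 3) ⊕ Fin 3 → ℤ) (b : Fin 3 → ℤ) : FI := ((t0LJ c b).getD dflt3).1
/-- `β(ρ₀)` enclosure. -/
def B0lj (c : (Fin 3 × Fin 3) ⊕ Fin 3 → ℤ) (b : Fin 3 → ℤ) : FI := (phiFI (Q0 c b)).getD (FI.ofInt 0)
/-- `α′(ρ₀)/ρ₀` enclosure. -/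
def A1qlj (c : (Fin 3 × Fin 3) ⊕ Fin 3 → ℤ) (b : Fin 3 → ℤ) : FI := (a1qLJ c b).getD (FI.ofInt 0)
/-- Scaled remainder constant. -/
def KSlj (c w : (Fin 3 × Fin 3) ⊕ Fin 3 → ℤ) (b : Fin 3 → ℤ) : ℤ :=
  kTermS ((ttLJ c w b).getD dflt3).1 ((ttLJ c w b).getD dflt3).2.1 ((ttLJ c w b).getD dflt3).2.2
/-- The label record (for `Darr`). -/
def recLJ (c w : (Fin 3 × Fin 3) ⊕ Fin 3 → ℤ) (b : Fin 3 → ℤ) : CenLabel := ⟨cenVec c b, wVec c b, A0lj c b, B0lj c b, A1qlj c b, KSlj c w b, nd2S2 c w b⟩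
/-- Naive rank-one coefficient enclosures `(α, β)` of the LJ profile over the box radius. -/
def naiveLJ (c w : (Fin 3 × Fin 3) ⊕ Fin 3 → ℤ) (b : Fin 3 → ℤ) : Option (FI × FI) :=
  match alphaLJFI (dot3 (vecB (boxE c w) (shufFI c w) b) (vecB (boxE c w) (shufFI c w) b)),
    phiFI (dot3 (vecB (boxE c w) (shufFI c w) b) (vecB (boxE c w) (shufFI c w) b)) with
  | some A, some B => some (A, B)
  | _, _ => none

/-- ★★ **The per-label floor from `ljLabelOK`**. [folklore chaining: `…HomCurvLJLabel.label_floor_LJ`] -/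
theorem labelLJ_floor {c w : (Fin 3 × Fin 3) ⊕ Fin 3 → ℤ} {b : Fin 3 → ℤ} (h : ljLabelOK c w b = true) (U : E3 →L[ℝ] E3)
    (hbox : ∀ ab : Fin 3 × Fin 3, |(U (EuclideanSpace.single ab.2 (1 : ℝ))) ab.1 - (c (Sum.inl ab) : ℝ) / SC| ≤ (w (Sum.inl ab) : ℝ) / SC)
    (η : E3) (hη : ∀ i : Fin 3, |η i - (c (Sum.inr i) : ℝ) / SC| ≤ (w (Sum.inr i) : ℝ) / SC) (Δ : E3) :
    FI.mem (alphaLJ ‖cenPt c b‖) (A0lj c b) ∧ FI.mem (betaLJ ‖cenPt c b‖) (B0lj c b) ∧ FI.mem (alpha1LJ ‖cenPt c b‖ / ‖cenPt c b‖) (A1qlj c b) ∧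
      alphaLJ ‖cenPt c b‖ * ⟪cenPt c b, Δ⟫ ^ 2 + betaLJ ‖cenPt c b‖ * ‖Δ‖ ^ 2 +
          ∑ i, ∑ j, (∑ k, (latPt U hexFrame b + U (hcpShift + η) - cenPt c b) k *
            Dreal (alpha1LJ ‖cenPt c b‖ / ‖cenPt c b‖) (alphaLJ ‖cenPt c b‖) (cenPt c b) k i j) * (Δ i * Δ j) -
          (KSlj c w b : ℝ) / SC / 2 * ((nd2S2 c w b : ℝ) / SC) * ‖Δ‖ ^ 2 ≤
        alphaLJ ‖latPt U hexFrame b + U (hcpShift + η)‖ * ⟪latPt U hexFrame b + U (hcpShift + η), Δ⟫ ^ 2 +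
          betaLJ ‖latPt U hexFrame b + U (hcpShift + η)‖ * ‖Δ‖ ^ 2 := by
  simp only [ljLabelOK, Bool.and_eq_true, decide_eq_true_eq] at h
  obtain ⟨⟨⟨⟨hlo, htt⟩, ht0⟩, hb0⟩, hq⟩ := h
  obtain ⟨tt, htt⟩ := Option.isSome_iff_exists.1 htt
  obtain ⟨t0, ht0⟩ := Option.isSome_iff_exists.1 ht0
  obtain ⟨B0, hb0⟩ := Option.isSome_iff_exists.1 hb0
  obtain ⟨a1q, hq⟩ := Option.isSome_iff_exists.1 hq
  have hq' : FI.divPos t0.2.1 (dot3 (cenVec c b) (cenVec c b)) = some a1q := by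
    rw [a1qLJ, ht0] at hq; simpa [Q0] using hq
  have eA : A0lj c b = t0.1 := by simp [A0lj, ht0]
  have eB : B0lj c b = B0 := by simp [B0lj, hb0]
  have e1 : A1qlj c b = a1q := by simp [A1qlj, hq]
  have eK : KSlj c w b = kTermS tt.1 tt.2.1 tt.2.2 := by simp [KSlj, htt]
  rw [eA, eB, e1, eK]
  exact label_floor_LJ hlo htt ht0 hb0 hq' U hbox η hη Δ

/-! ## §2. The Boolean and the computed floor -/

/-- Centre matrix `Σ_{Lc} h_b(p_b)` (LJ coefficients). -/
def EcLJ (c : (Fin 3 × Fin 3) ⊕ Fin 3 → ℤ) (Lc : List (Fin 3 → ℤ)) (i j : Fin 3) : FI :=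
  hessEntryFI Lc (fun b => A0lj c b) (fun b => B0lj c b) (fun b => cenVec c b) i j
/-- Naive matrix `Σ_{Ln} h_b(C_b)` (box data, LJ coefficients). -/
def EnLJ (c w : (Fin 3 × Fin 3) ⊕ Fin 3 → ℤ) (Ln : List (Fin 3 → ℤ)) (i j : Fin 3) : FI :=
  hessEntryFI Ln (fun b => ((naiveLJ c w b).getD (FI.ofInt 0, FI.ofInt 0)).1) (fun b => ((naiveLJ c w b).getD (FI.ofInt 0, FI.ofInt 0)).2)
    (fun b => vecB (boxE c w) (shufFI c w) b) i j
/-- First-order array `G_kl,ij`. -/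
def GarrLJ (c w : (Fin 3 × Fin 3) ⊕ Fin 3 → ℤ) (Lc : List (Fin 3 → ℤ)) (k l i j : Fin 3) : FI :=
  accFI Lc fun b => (Darr (recLJ c w b) k i j).mul (wVec c b l)
/-- First-order array `T_k,ij`. -/
def TarrLJ (c w : (Fin 3 × Fin 3) ⊕ Fin 3 → ℤ) (Lc : List (Fin 3 → ℤ)) (k i j : Fin 3) : FI := accFI Lc fun b => Darr (recLJ c w b) k i j
/-- Scaled entrywise bound of the first-order perturbation. -/
def WmatLJ (c w : (Fin 3 × Fin 3) ⊕ Fin 3 → ℤ) (Lc : List (Fin 3 → ℤ)) (i j : Fin 3) : ℤ :=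
  cdiv (∑ k : Fin 3, ∑ l : Fin 3, w (Sum.inl (k, l)) * (GarrLJ c w Lc k l i j).absHi + ∑ k : Fin 3, uBound c w k * (TarrLJ c w Lc k i j).absHi) SC
/-- Scaled one-sided second-order remainder. -/
def remLJ (c w : (Fin 3 × Fin 3) ⊕ Fin 3 → ℤ) (Lc : List (Fin 3 → ℤ)) : ℤ := (Lc.map fun b => cdiv (KSlj c w b * nd2S2 c w b) (2 * SC)).sum

/-- ★ **THE CENTRED LJ CURVATURE CHECK** over the box `(c, w)`, centred labels `Lc`, naive labels `Ln`, floor `lamS/SC`. -/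
def curvCheckLJ (c w : (Fin 3 × Fin 3) ⊕ Fin 3 → ℤ) (Lc Ln : List (Fin 3 → ℤ)) (lamS : ℤ) : Bool :=
  (Lc.all fun b => ljLabelOK c w b) && (Ln.all fun b => (naiveLJ c w b).isSome) &&
    hertzTest (fun i j => (EcLJ c Lc i j).add (EnLJ c w Ln i j)) (WmatLJ c w Lc) (lamS + remLJ c w Lc)

/-- ★ **The computed LJ curvature floor** (best sign-vertex floor minus the remainder; `none` if the search fails). -/
def curvLamLJ (c w : (Fin 3 × Fin 3) ⊕ Fin 3 → ℤ) (Lc Ln : List (Fin 3 → ℤ)) : Option ℤ :=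
  (hertzSup (fun i j => (EcLJ c Lc i j).add (EnLJ c w Ln i j)) (WmatLJ c w Lc)).map fun κ => κ - remLJ c w Lc

/-- The computed floor passes the leaf. [formal bookkeeping] -/
theorem curvCheckLJ_of_curvLamLJ {c w : (Fin 3 × Fin 3) ⊕ Fin 3 → ℤ} {Lc Ln : List (Fin 3 → ℤ)} {lamS : ℤ}
    (h : curvLamLJ c w Lc Ln = some lamS) (hcen : (Lc.all fun b => ljLabelOK c w b) = true) (hnai : (Ln.all fun b => (naiveLJ c w b).isSome) = true) :
    curvCheckLJ c w Lc Ln lamS = true := by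
  unfold curvLamLJ at h
  cases hs : hertzSup (fun i j => (EcLJ c Lc i j).add (EnLJ c w Ln i j)) (WmatLJ c w Lc) with
  | none => rw [hs] at h; exact absurd h (by simp)
  | some κ =>
    rw [hs] at h
    simp only [Option.map_some, Option.some.injEq] at h
    have hκ := hertzSup_spec hs
    unfold curvCheckLJ
    simp only [Bool.and_eq_true]
    refine ⟨⟨hcen, hnai⟩, ?_⟩
    rw [← h, sub_add_cancel]
    exact hκ

/-! ## §3. ★★★ Soundness in the `hcurv` shape of the ring lemma -/

/-- The remainder sum is below `remLJ/SC`. [arithmetic] -/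
theorem remLJ_sum_le (c w : (Fin 3 × Fin 3) ⊕ Fin 3 → ℤ) {Lc : List (Fin 3 → ℤ)} (hLc : Lc.Nodup) :
    ∑ b ∈ Lc.toFinset, (KSlj c w b : ℝ) / SC / 2 * ((nd2S2 c w b : ℝ) / SC) ≤ (remLJ c w Lc : ℝ) / SC := by
  classical
  have h1 : ∑ b ∈ Lc.toFinset, (KSlj c w b : ℝ) / SC / 2 * ((nd2S2 c w b : ℝ) / SC) ≤
      ∑ b ∈ Lc.toFinset, ((cdiv (KSlj c w b * nd2S2 c w b) (2 * SC) : ℤ) : ℝ) / SC := Finset.sum_le_sum fun b _ => rem_term_le _ _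
  refine h1.trans (le_of_eq ?_)
  rw [← Finset.sum_div]
  congr 1
  rw [List.sum_toFinset _ hLc, remLJ, Int.cast_list_sum, List.map_map]
  rfl

/-- Naive coefficient memberships. [folklore chaining] -/
theorem mem_naiveLJ {c w : (Fin 3 × Fin 3) ⊕ Fin 3 → ℤ} {b : Fin 3 → ℤ} {AB : FI × FI} (h : naiveLJ c w b = some AB) {ρ : ℝ}
    (hq : FI.mem (ρ ^ 2) (dot3 (vecB (boxE c w) (shufFI c w) b) (vecB (boxE c w) (shufFI c w) b))) :
    FI.mem (alphaLJ ρ) AB.1 ∧ FI.mem (betaLJ ρ) AB.2 := by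
  unfold naiveLJ at h
  cases hA : alphaLJFI (dot3 (vecB (boxE c w) (shufFI c w) b) (vecB (boxE c w) (shufFI c w) b)) with
  | none => rw [hA] at h; exact absurd h (by simp)
  | some A =>
    cases hB : phiFI (dot3 (vecB (boxE c w) (shufFI c w) b) (vecB (boxE c w) (shufFI c w) b)) with
    | none => rw [hA, hB] at h; exact absurd h (by simp)
    | some B =>
      rw [hA, hB] at h
      simp only [Option.some.injEq] at h
      subst h
      have ma := mem_alphaLJFI hq hA
      have ea : 14 * ((ρ ^ 2)⁻¹) ^ 8 - 8 * ((ρ ^ 2)⁻¹) ^ 5 = alphaLJ ρ := by rw [alphaLJ, ← inv_pow, ← pow_mul, ← pow_mul]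
      rw [ea] at ma
      exact ⟨ma, betaLJ_of_mem_phiFI hq hB⟩

/-- ★★★ **SOUNDNESS OF THE LJ CURVATURE LEAF** (the `hcurv` input of `…HomForceRing.hcpForceLJ_slab_confinement` with `B := (Lc ++ Ln).toFinset`):
for `U` with entries in the box, `‖U − 1‖ ≤ 1/4`, shuffles `ξ₀, ξ` in the box with norms `≤ 1/4`, every `s ∈ (0,1)`:
`(lamS/SC)·‖U(ξ−ξ₀)‖² ≤ Σ_b segGd (fun x => x⁻¹^7 − x⁻¹^13) (latPt U hexFrame b + U(hcpShift+ξ₀)) (U(ξ−ξ₀)) s`. [folklore chaining] -/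
theorem curvLJ_floor_of_check {c w : (Fin 3 × Fin 3) ⊕ Fin 3 → ℤ} {Lc Ln : List (Fin 3 → ℤ)} (hL : (Lc ++ Ln).Nodup) {lamS : ℤ}
    (h : curvCheckLJ c w Lc Ln lamS = true) (U : E3 →L[ℝ] E3) (hU : ‖U - 1‖ ≤ 1 / 4)
    (hbox : ∀ ab : Fin 3 × Fin 3, |(U (EuclideanSpace.single ab.2 (1 : ℝ))) ab.1 - (c (Sum.inl ab) : ℝ) / SC| ≤ (w (Sum.inl ab) : ℝ) / SC)
    (ξ₀ ξ : E3) (hξ₀ : ∀ i : Fin 3, |ξ₀ i - (c (Sum.inr i) : ℝ) / SC| ≤ (w (Sum.inr i) : ℝ) / SC)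
    (hξ : ∀ i : Fin 3, |ξ i - (c (Sum.inr i) : ℝ) / SC| ≤ (w (Sum.inr i) : ℝ) / SC) (hn₀ : ‖ξ₀‖ ≤ 1 / 4) (hn : ‖ξ‖ ≤ 1 / 4)
    {s : ℝ} (hs : s ∈ Set.Ioo (0 : ℝ) 1) :
    (lamS : ℝ) / SC * ‖U (ξ - ξ₀)‖ ^ 2 ≤
      ∑ b ∈ (Lc ++ Ln).toFinset, segGd (fun x : ℝ => x⁻¹ ^ 7 - x⁻¹ ^ 13) (latPt U hexFrame b + U (hcpShift + ξ₀)) (U (ξ - ξ₀)) s := by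
  classical
  have hS : (0 : ℝ) < SC := by norm_num [SC]
  unfold curvCheckLJ at h
  simp only [Bool.and_eq_true, List.all_eq_true] at h
  obtain ⟨⟨hcen, hnai⟩, hhz⟩ := h
  obtain ⟨hLc, hLn, hdisj⟩ := List.nodup_append.1 hL
  have hdisj' : List.Disjoint Lc Ln := fun a ha hb => hdisj a ha a hb rfl
  -- the intermediate shuffle
  set η : E3 := ξ₀ + s • (ξ - ξ₀) with hη
  have hηbox : ∀ i : Fin 3, |η i - (c (Sum.inr i) : ℝ) / SC| ≤ (w (Sum.inr i) : ℝ) / SC := by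
    intro i
    have : η i = ξ₀ i + s * (ξ i - ξ₀ i) := by simp [hη]
    rw [this]
    exact abs_sub_le_of_segment (hξ₀ i) (hξ i) hs.1.le hs.2.le
  have hηn : ‖η‖ ≤ 1 / 4 := by
    have hdec : η = (1 - s) • ξ₀ + s • ξ := by
      rw [hη, smul_sub, sub_smul, one_smul]; abel
    rw [hdec]
    calc ‖(1 - s) • ξ₀ + s • ξ‖ ≤ ‖(1 - s) • ξ₀‖ + ‖s • ξ‖ := norm_add_le _ _
      _ = (1 - s) * ‖ξ₀‖ + s * ‖ξ‖ := by
          rw [norm_smul, norm_smul, Real.norm_eq_abs, Real.norm_eq_abs, abs_of_nonneg (by linarith [hs.2]), abs_of_nonneg hs.1.le]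
      _ ≤ (1 - s) * (1 / 4) + s * (1 / 4) := by gcongr <;> linarith [hs.1, hs.2]
      _ = 1 / 4 := by ring
  have hpt : ∀ b : Fin 3 → ℤ, latPt U hexFrame b + U (hcpShift + ξ₀) + s • U (ξ - ξ₀) = latPt U hexFrame b + U (hcpShift + η) := by
    intro b
    have : U (hcpShift + η) = U (hcpShift + ξ₀) + s • U (ξ - ξ₀) := by
      rw [hη, ← map_smul, ← map_add]; congr 1; abel
    rw [this, add_assoc]
  set Δ : E3 := U (ξ - ξ₀) with hΔ
  set cb : (Fin 3 → ℤ) → E3 := fun b => latPt U hexFrame b + U (hcpShift + η) with hcb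
  have hρpos : ∀ b : Fin 3 → ℤ, 0 < ‖cb b‖ := fun b => lt_trans (by norm_num) (norm_shifted_gt hU hηn b)
  have hsegR : ∀ b : Fin 3 → ℤ, segR (latPt U hexFrame b + U (hcpShift + ξ₀)) Δ s = ‖cb b‖ := by
    intro b; rw [segR, hpt]
  -- the summands are `alphaLJ‖c_b‖⟪c_b,Δ⟫² + betaLJ‖c_b‖‖Δ‖²`
  have hsummand : ∀ b ∈ (Lc ++ Ln).toFinset,
      segGd (fun x : ℝ => x⁻¹ ^ 7 - x⁻¹ ^ 13) (latPt U hexFrame b + U (hcpShift + ξ₀)) Δ s = alphaLJ ‖cb b‖ * ⟪cb b, Δ⟫ ^ 2 + betaLJ ‖cb b‖ * ‖Δ‖ ^ 2 := by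
    intro b _
    have h0 : segR (latPt U hexFrame b + U (hcpShift + ξ₀)) Δ s ≠ 0 := by rw [hsegR]; exact (hρpos b).ne'
    rw [segGd_ljProfile_eq _ _ h0, hsegR, hpt]
  rw [Finset.sum_congr rfl hsummand, List.toFinset_append, Finset.sum_union (List.disjoint_toFinset_iff_disjoint.2 hdisj')]
  -- NAIVE part
  have hCn : ∀ (b : Fin 3 → ℤ) (a : Fin 3), FI.mem (cb b a) (vecB (boxE c w) (shufFI c w) b a) :=
    fun b a => mem_vecB U η (fun ab => mem_entryFI (hbox ab)) (fun i => mem_shufFI (hηbox i)) b a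
  have hQn : ∀ b : Fin 3 → ℤ, FI.mem (‖cb b‖ ^ 2) (dot3 (vecB (boxE c w) (shufFI c w) b) (vecB (boxE c w) (shufFI c w) b)) := by
    intro b; rw [← real_inner_self_eq_norm_sq]; exact mem_dot3 (hCn b) (hCn b)
  have hαn : ∀ b ∈ Ln, FI.mem (alphaLJ ‖cb b‖) ((naiveLJ c w b).getD (FI.ofInt 0, FI.ofInt 0)).1 ∧
      FI.mem (betaLJ ‖cb b‖) ((naiveLJ c w b).getD (FI.ofInt 0, FI.ofInt 0)).2 := by
    intro b hb
    obtain ⟨AB, hAB⟩ := Option.isSome_iff_exists.1 (hnai b hb)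
    have := mem_naiveLJ hAB (hQn b)
    rw [hAB]; simpa using this
  have hMn := fun i j => mem_hessEntryFI Ln hLn (fun b hb => (hαn b hb).1) (fun b hb => (hαn b hb).2) (fun b _ a => hCn b a) i j
  have hNsum := labelSum_eq_form Ln.toFinset (fun b => alphaLJ ‖cb b‖) (fun b => betaLJ ‖cb b‖) cb Δ
  -- CENTRED part
  have hlf := fun b (hb : b ∈ Lc) => labelLJ_floor (hcen b hb) U hbox η hηbox Δ
  set pc : (Fin 3 → ℤ) → E3 := fun b => cenPt c b with hpc
  set a1 : (Fin 3 → ℤ) → ℝ := fun b => alpha1LJ ‖pc b‖ / ‖pc b‖ with ha1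
  set D : (Fin 3 → ℤ) → Fin 3 → Fin 3 → Fin 3 → ℝ := fun b k i j => Dreal (a1 b) (alphaLJ ‖pc b‖) (pc b) k i j with hD
  have hfloor : ∀ b ∈ Lc.toFinset, alphaLJ ‖pc b‖ * ⟪pc b, Δ⟫ ^ 2 + betaLJ ‖pc b‖ * ‖Δ‖ ^ 2 +
      ∑ i, ∑ j, (∑ k, (cb b - pc b) k * D b k i j) * (Δ i * Δ j) - (KSlj c w b : ℝ) / SC / 2 * ((nd2S2 c w b : ℝ) / SC) * ‖Δ‖ ^ 2 ≤
      alphaLJ ‖cb b‖ * ⟪cb b, Δ⟫ ^ 2 + betaLJ ‖cb b‖ * ‖Δ‖ ^ 2 := fun b hb => (hlf b (List.mem_toFinset.1 hb)).2.2.2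
  have hC := sum_floor_collect Lc.toFinset (fun b => alphaLJ ‖cb b‖ * ⟪cb b, Δ⟫ ^ 2 + betaLJ ‖cb b‖ * ‖Δ‖ ^ 2)
    (fun b => alphaLJ ‖pc b‖ * ⟪pc b, Δ⟫ ^ 2 + betaLJ ‖pc b‖ * ‖Δ‖ ^ 2) (fun b => (KSlj c w b : ℝ) / SC / 2 * ((nd2S2 c w b : ℝ) / SC))
    (fun b k => (cb b - pc b) k) D Δ hfloor
  have hqsum := labelSum_eq_form Lc.toFinset (fun b => alphaLJ ‖pc b‖) (fun b => betaLJ ‖pc b‖) pc Δ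
  have hMc := fun i j => mem_hessEntryFI Lc hLc (fun b hb => (hlf b hb).1) (fun b hb => (hlf b hb).2.1) (fun b _ a => mem_cenVec c b a) i j
  -- the perturbation array and its entrywise bound
  set P : Fin 3 → Fin 3 → ℝ := fun i j => ∑ b ∈ Lc.toFinset, ∑ k, (cb b - pc b) k * D b k i j with hP
  have hPbound : ∀ i j, |P i j| * SC ≤ (WmatLJ c w Lc i j : ℝ) := by
    intro i j
    have hd : ∀ (b : Fin 3 → ℤ) (k : Fin 3), (cb b - pc b) k =
        ∑ l : Fin 3, ((U (EuclideanSpace.single l (1 : ℝ))) k - (c (Sum.inl (k, l)) : ℝ) / SC) * wPt c b l + (U (η - cenShuf c)) k :=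
      fun b k => dVec_formula c U η b k
    have hre : P i j = ∑ k, ∑ l, ((U (EuclideanSpace.single l (1 : ℝ))) k - (c (Sum.inl (k, l)) : ℝ) / SC) *
        (∑ b ∈ Lc.toFinset, wPt c b l * D b k i j) + ∑ k, (U (η - cenShuf c)) k * ∑ b ∈ Lc.toFinset, D b k i j := by
      rw [hP]
      simp only []
      rw [Finset.sum_congr rfl fun b _ => Finset.sum_congr rfl fun k _ => by rw [hd b k]]
      exact pert_rearrange Lc.toFinset (fun k l => (U (EuclideanSpace.single l (1 : ℝ))) k - (c (Sum.inl (k, l)) : ℝ) / SC)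
        (fun k => (U (η - cenShuf c)) k) (fun b l => wPt c b l) (fun b k => D b k i j)
    have hG : ∀ k l, FI.mem (∑ b ∈ Lc.toFinset, wPt c b l * D b k i j) (GarrLJ c w Lc k l i j) := by
      intro k l
      refine mem_accFI Lc hLc fun b hb => ?_
      rw [mul_comm]
      exact FI.mem_mul (mem_Darr (L := recLJ c w b) (hlf b hb).2.2.1 (hlf b hb).1 (fun a => mem_cenVec c b a) k i j) (mem_wVec c b l)
    have hT : ∀ k, FI.mem (∑ b ∈ Lc.toFinset, D b k i j) (TarrLJ c w Lc k i j) := by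
      intro k
      exact mem_accFI Lc hLc fun b hb => mem_Darr (L := recLJ c w b) (hlf b hb).2.2.1 (hlf b hb).1 (fun a => mem_cenVec c b a) k i j
    have habs := pert_abs_le (fun k l => (U (EuclideanSpace.single l (1 : ℝ))) k - (c (Sum.inl (k, l)) : ℝ) / SC)
      (fun k l => ∑ b ∈ Lc.toFinset, wPt c b l * D b k i j) (fun k l => (w (Sum.inl (k, l)) : ℝ) / SC)
      (fun k l => ((GarrLJ c w Lc k l i j).absHi : ℝ) / SC) (fun k => (U (η - cenShuf c)) k) (fun k => ∑ b ∈ Lc.toFinset, D b k i j)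
      (fun k => (uBound c w k : ℝ) / SC) (fun k => ((TarrLJ c w Lc k i j).absHi : ℝ) / SC)
      (fun k l => hbox (k, l)) (fun k l => by rw [le_div_iff₀ hS]; exact FI.abs_le_absHi (hG k l))
      (fun k => by rw [le_div_iff₀ hS]; exact abs_shift_le U hbox η hηbox k) (fun k => by rw [le_div_iff₀ hS]; exact FI.abs_le_absHi (hT k))
    rw [← hre] at habs
    have hsum : (∑ k : Fin 3, ∑ l : Fin 3, (w (Sum.inl (k, l)) : ℝ) / SC * (((GarrLJ c w Lc k l i j).absHi : ℝ) / SC) +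
        ∑ k : Fin 3, (uBound c w k : ℝ) / SC * (((TarrLJ c w Lc k i j).absHi : ℝ) / SC)) * SC =
        ((∑ k : Fin 3, ∑ l : Fin 3, w (Sum.inl (k, l)) * (GarrLJ c w Lc k l i j).absHi + ∑ k : Fin 3, uBound c w k * (TarrLJ c w Lc k i j).absHi : ℤ) : ℝ) / SC := by
      push_cast
      rw [eq_div_iff hS.ne']
      simp only [add_mul, Finset.sum_mul]
      congr 1
      · refine Finset.sum_congr rfl fun k _ => Finset.sum_congr rfl fun l _ => ?_
        field_simp
      · refine Finset.sum_congr rfl fun k _ => ?_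
        field_simp
    have hcd := div_le_cdiv (a := ∑ k : Fin 3, ∑ l : Fin 3, w (Sum.inl (k, l)) * (GarrLJ c w Lc k l i j).absHi +
      ∑ k : Fin 3, uBound c w k * (TarrLJ c w Lc k i j).absHi) (b := (SC : ℤ)) (by exact_mod_cast hS)
    calc |P i j| * SC ≤ _ := mul_le_mul_of_nonneg_right habs hS.le
      _ = _ := hsum
      _ ≤ (WmatLJ c w Lc i j : ℝ) := by rw [WmatLJ]; exact_mod_cast hcd
  -- remainder
  have hR := remLJ_sum_le c w (Lc := Lc) hLc
  -- the sign-vertex test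
  have key := quadForm_ge_of_hertzTest hhz (M := fun i j => (∑ b ∈ Lc.toFinset, (alphaLJ ‖pc b‖ * (pc b i * pc b j) + if i = j then betaLJ ‖pc b‖ else 0)) +
      ∑ b ∈ Ln.toFinset, (alphaLJ ‖cb b‖ * (cb b i * cb b j) + if i = j then betaLJ ‖cb b‖ else 0)) (P := P)
    (fun i j => FI.mem_add (hMc i j) (hMn i j)) hPbound (fun i => Δ i)
  rw [form_add3, ← hqsum, ← hNsum, ← norm_sq_eq_sum] at key
  have hΔ2 : 0 ≤ ‖Δ‖ ^ 2 := sq_nonneg _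
  have hcast : (((lamS + remLJ c w Lc : ℤ) : ℝ)) / SC = (lamS : ℝ) / SC + (remLJ c w Lc : ℝ) / SC := by push_cast; ring
  rw [hcast] at key
  have hRle : (∑ b ∈ Lc.toFinset, (KSlj c w b : ℝ) / SC / 2 * ((nd2S2 c w b : ℝ) / SC)) * ‖Δ‖ ^ 2 ≤ (remLJ c w Lc : ℝ) / SC * ‖Δ‖ ^ 2 :=
    mul_le_mul_of_nonneg_right hR hΔ2
  nlinarith [key, hC, hRle, hΔ2]

end Summit.AtomisticToContinuum.Crystallization.Theorems.FrustratedLawDichotomyStrainedPatchHomCurvLJ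

end
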